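import Mathlib.NumberTheory.ArithmeticFunction.Misc
import Mathlib.Analysis.SpecialFunctions.Pow.Real
import Mathlib.Algebra.Field.GeomSum
import Mathlib.Data.Nat.Factorization.Induction
import Mathlib.Tactic.IntervalCases
import Mathlib.Tactic.NormNum.Prime
import Mathlib.Tactic.NormNum.GCD
import Literature.NumberTheory.LFunctions.ColossallyAbundant
import HarnessLib

/-!
# `55440` is colossally abundant (a certified table entry)

Topic: `Literature/NumberTheory/LFunctions`. Discharges the tabular named fact
`Nat.colossallyAbundant_55440` of `RobinCriterion.lean` (provefact `Literature.NumberTheory.LFunctions.robin_iff`, leaf of the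
DAG of Robin 1984, Thm. 1): `55440 = 2⁴·3²·5·7·11` is colossally abundant in the sense of
`Nat.ColossallyAbundant` (Alaoglu–Erdős 1944, §3, table; Caveney–Nicolas–Sondow 2012, §2:
`…, 5040, 55440, 720720, …`).

## Proof (Alaoglu–Erdős 1944, §3 / Caveney–Nicolas–Sondow 2012, §2, made explicit)

Take the parameter `ε = 1/30` (any `ε` with `x₁(ε) ∈ [11, 13)`, `x₂(ε) ∈ [3, 5)`, `x₃(ε), x₄(ε) ∈
[2, 3)`, `x₅(ε) < 2` works; `1/30 ∈ [F(13,1), F(11,1)] = [0.0312…, 0.0363…]`). The function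
`G(m) = σ(m)/m^{1+ε}` is multiplicative, so `G(m) = ∏_{p^k ‖ m} G(p^k)`, and prime by prime
`G(p^k) ≤ B_p` with `B_2 = G(2⁴)`, `B_3 = G(3²)`, `B_5 = G(5)`, `B_7 = G(7)`, `B_11 = G(11)` and
`B_p = 1` for `p ≥ 13`; since `B_p ≥ 1`, `G(m) ≤ ∏_{p ≤ 11} B_p = G(55440)`. Each prime-power
comparison is a polynomial inequality in `t_p = p^{1/30}` decided through `t_p^{30} = p` and exact
rational arithmetic (e.g. `t_13 ≥ 13/12 ⇔ 13 ≥ (13/12)^{30}`); large exponents `k` are handled by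
the geometric bound `σ(p^k) ≤ p^k · p/(p−1)`.

## Contents

* `Nat.CA55440.G`, `Nat.CA55440.t`, the prime-power bounds, and
* `Nat.colossallyAbundant_55440_holds : Nat.ColossallyAbundant 55440`.

## Sources

* L. Alaoglu, P. Erdős, *On highly composite and similar numbers*, Trans. AMS 56 (1944), §3.
  [AlaogluErdos1944]
* G. Caveney, J.-L. Nicolas, J. Sondow, *On SA, CA, and GA numbers*, Ramanujan J. 29 (2012), §2
  (parameters, `x_k(ε)`, `F(p,k)`, the list of CA numbers). [CaveneyNicolasSondow2012]
-/

noncomputable section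

open Real Finset
open scoped ArithmeticFunction.sigma

namespace Nat

namespace CA55440

/-! ### The parameter `ε = 1/30` and `t p = p^ε` -/

/-- The parameter `ε = 1/30` used to certify `55440`. [cite: CaveneyNicolasSondow2012, §2] -/
def ε : ℝ := ((30 : ℕ) : ℝ)⁻¹

/-- `t p = p^ε = p^{1/30}`. [cite: CaveneyNicolasSondow2012, §2] -/
def t (p : ℕ) : ℝ := (p : ℝ) ^ ε

/-- `G m = σ(m)/m^{1+ε}`, the quantity maximised by a colossally abundant number of parameter `ε`.
[cite: CaveneyNicolasSondow2012, §2] -/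
def G (m : ℕ) : ℝ := (σ 1 m : ℝ) / (m : ℝ) ^ (1 + ε)

/-- [folklore] -/
theorem ε_pos : 0 < ε := by unfold ε; positivity

/-- [folklore] -/
theorem t_nonneg (p : ℕ) : 0 ≤ t p := rpow_nonneg (Nat.cast_nonneg _) _

/-- [folklore] -/
theorem t_pos {p : ℕ} (hp : 0 < p) : 0 < t p := rpow_pos_of_pos (by exact_mod_cast hp) _

/-- `t p ^ 30 = p`. [folklore] -/
theorem t_pow (p : ℕ) : t p ^ 30 = p := rpow_inv_natCast_pow (Nat.cast_nonneg _) (by norm_num)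

/-- [folklore] -/
theorem one_lt_t {p : ℕ} (hp : 2 ≤ p) : 1 < t p :=
  one_lt_rpow (by exact_mod_cast (show 1 < p by omega)) ε_pos

/-- [folklore] -/
theorem t_mono {p q : ℕ} (h : p ≤ q) : t p ≤ t q :=
  rpow_le_rpow (Nat.cast_nonneg _) (by exact_mod_cast h) ε_pos.le

/-- `t p ≤ c ↔ p ≤ c³⁰`. [folklore] -/
theorem t_le_iff {p : ℕ} {c : ℝ} (hc : 0 ≤ c) : t p ≤ c ↔ (p : ℝ) ≤ c ^ 30 := by
  rw [← t_pow p]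
  exact (pow_le_pow_iff_left₀ (t_nonneg p) hc (by norm_num)).symm

/-- `c ≤ t p ↔ c³⁰ ≤ p`. [folklore] -/
theorem le_t_iff {p : ℕ} {c : ℝ} (hc : 0 ≤ c) : c ≤ t p ↔ c ^ 30 ≤ (p : ℝ) := by
  rw [← t_pow p]
  exact (pow_le_pow_iff_left₀ hc (t_nonneg p) (by norm_num)).symm

/-- `t p ^ j ≤ c ↔ p ≤ c ^ n` when `j n = 30`. [folklore] -/
theorem t_pow_le_iff {p : ℕ} {c : ℝ} (hc : 0 ≤ c) {j n : ℕ} (hn : n ≠ 0) (hjn : j * n = 30) :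
    t p ^ j ≤ c ↔ (p : ℝ) ≤ c ^ n := by
  rw [← t_pow p, ← hjn, pow_mul]
  exact (pow_le_pow_iff_left₀ (pow_nonneg (t_nonneg p) _) hc hn).symm

/-- `c ≤ t p ^ j ↔ c ^ n ≤ p` when `j n = 30`. [folklore] -/
theorem le_t_pow_iff {p : ℕ} {c : ℝ} (hc : 0 ≤ c) {j n : ℕ} (hn : n ≠ 0) (hjn : j * n = 30) :
    c ≤ t p ^ j ↔ c ^ n ≤ (p : ℝ) := by
  rw [← t_pow p, ← hjn, pow_mul]
  exact (pow_le_pow_iff_left₀ hc (pow_nonneg (t_nonneg p) _) hn).symm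

/-! ### `G` is multiplicative; value at prime powers -/

/-- [folklore] -/
theorem G_nonneg (m : ℕ) : 0 ≤ G m := by unfold G; positivity

/-- [folklore] -/
theorem G_one : G 1 = 1 := by simp [G]

/-- [folklore] -/
theorem G_mul {m n : ℕ} (h : Coprime m n) : G (m * n) = G m * G n := by
  unfold G
  rw [ArithmeticFunction.isMultiplicative_sigma.map_mul_of_coprime h, Nat.cast_mul, Nat.cast_mul,
    mul_rpow (Nat.cast_nonneg _) (Nat.cast_nonneg _)]
  ring

/-- `G(m) = ∏_{p^k ‖ m} G(p^k)`. [folklore] -/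
theorem G_eq_prod {m : ℕ} (hm : m ≠ 0) :
    G m = ∏ p ∈ m.primeFactors, G (p ^ m.factorization p) := by
  rw [Nat.multiplicative_factorization G (fun _ _ h => G_mul h) G_one hm, Finsupp.prod,
    support_factorization]

/-- `G(p^k) = (∑_{i ≤ k} p^i) / (p · t_p)^k`. [folklore] -/
theorem G_prime_pow {p : ℕ} (hp : p.Prime) (k : ℕ) :
    G (p ^ k) = (∑ i ∈ range (k + 1), (p : ℝ) ^ i) / ((p : ℝ) * t p) ^ k := by
  have hp0 : (0 : ℝ) < p := by exact_mod_cast hp.pos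
  unfold G
  rw [ArithmeticFunction.sigma_one_apply_prime_pow hp]
  push_cast
  congr 1
  rw [← rpow_natCast_mul hp0.le, mul_comm, rpow_mul_natCast hp0.le, rpow_add hp0, rpow_one]
  rfl

/-- The geometric bound `∑_{i ≤ k} p^i ≤ p^k · p/(p−1)` (`p > 1`). [folklore] -/
theorem geom_le {p : ℝ} (hp : 1 < p) (k : ℕ) :
    ∑ i ∈ range (k + 1), p ^ i ≤ p ^ k * (p / (p - 1)) := by
  have hp1 : p - 1 > 0 := by linarith
  rw [geom_sum_eq (by linarith) (k + 1), div_le_iff₀ hp1, pow_succ]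
  have : p ^ k * (p / (p - 1)) * (p - 1) = p ^ k * p := by field_simp
  rw [this]
  linarith

/-- Tail bound: `G(p^k) ≤ (p/(p−1)) / t_p^k`. [folklore] -/
theorem G_prime_pow_le_tail {p : ℕ} (hp : p.Prime) (k : ℕ) :
    G (p ^ k) ≤ ((p : ℝ) / (p - 1)) / t p ^ k := by
  have hp1 : (1 : ℝ) < p := by exact_mod_cast hp.one_lt
  have hp0 : (0 : ℝ) < p := by linarith
  have ht : 0 < t p := t_pos hp.pos
  rw [G_prime_pow hp, mul_pow, div_le_iff₀ (by positivity)]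
  calc ∑ i ∈ range (k + 1), (p : ℝ) ^ i ≤ (p : ℝ) ^ k * (p / (p - 1)) := geom_le hp1 k
    _ = (p : ℝ) / (p - 1) / t p ^ k * ((p : ℝ) ^ k * t p ^ k) := by
      field_simp

/-- The tail bound decreases in `k` (`t_p > 1`). [folklore] -/
theorem tail_antitone {p : ℕ} (hp : p.Prime) {k₀ k : ℕ} (h : k₀ ≤ k) :
    ((p : ℝ) / (p - 1)) / t p ^ k ≤ ((p : ℝ) / (p - 1)) / t p ^ k₀ := by
  have hp1 : (1 : ℝ) < p := by exact_mod_cast hp.one_lt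
  have ht : 1 < t p := one_lt_t hp.two_le
  have hnum : 0 ≤ (p : ℝ) / (p - 1) := div_nonneg (by linarith) (by linarith)
  exact div_le_div_of_nonneg_left hnum (by positivity) (pow_le_pow_right₀ ht.le h)

/-- `G(p^k) ≤ (p/(p−1)) / t_p^{k₀}` for `k ≥ k₀`. [folklore] -/
theorem G_prime_pow_le_tail_of_le {p : ℕ} (hp : p.Prime) {k₀ k : ℕ} (h : k₀ ≤ k) :
    G (p ^ k) ≤ ((p : ℝ) / (p - 1)) / t p ^ k₀ :=
  (G_prime_pow_le_tail hp k).trans (tail_antitone hp h)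

/-! ### Prime-by-prime bounds -/

/-- Primes `p ≥ 13` do not divide the maximiser: `G(p^k) ≤ 1` (`t_p ≥ t_13 ≥ 13/12 ≥ p/(p−1)`,
using `13 ≥ (13/12)^{30}`). [cite: CaveneyNicolasSondow2012, §2] -/
theorem G_prime_pow_le_one {p : ℕ} (hp : p.Prime) (h13 : 13 ≤ p) (k : ℕ) : G (p ^ k) ≤ 1 := by
  rcases Nat.eq_zero_or_pos k with rfl | hk
  · simp [G_one]
  have hp1 : (13 : ℝ) ≤ p := by exact_mod_cast h13
  have ht13 : (13 / 12 : ℝ) ≤ t 13 := by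
    rw [le_t_iff (by norm_num)]
    norm_num
  have htp : (13 / 12 : ℝ) ≤ t p := ht13.trans (t_mono h13)
  have hfrac : (p : ℝ) / (p - 1) ≤ 13 / 12 := by
    rw [div_le_iff₀ (by linarith)]
    linarith
  calc G (p ^ k) ≤ ((p : ℝ) / (p - 1)) / t p ^ 1 := G_prime_pow_le_tail_of_le hp hk
    _ ≤ 1 := by
      rw [pow_one, div_le_one (by linarith)]
      exact hfrac.trans htp

/-- `p = 11`: exponent `1` is optimal, `G(11^k) ≤ G(11)`. [cite: CaveneyNicolasSondow2012, §2] -/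
theorem G_eleven_pow_le (k : ℕ) : G (11 ^ k) ≤ G 11 := by
  have h11 : G 11 = 12 / (11 * t 11) := by
    have := G_prime_pow (by norm_num : (11).Prime) 1
    norm_num at this
    rw [this]
  have ht : 0 < t 11 := t_pos (by norm_num)
  rcases Nat.lt_or_ge k 2 with hk | hk
  · interval_cases k
    · -- `G 1 = 1 ≤ G 11` : `t ≤ 12/11`
      rw [pow_zero, G_one, h11, le_div_iff₀ (by positivity)]
      have : t 11 ≤ 12 / 11 := by rw [t_le_iff (by norm_num)]; norm_num
      linarith
    · simp
  · -- tail with `k₀ = 2`: `(11/10)/t² ≤ 12/(11 t)` iff `121/120 ≤ t`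
    refine (G_prime_pow_le_tail_of_le (by norm_num) hk).trans ?_
    rw [h11]
    have hlow : (121 / 120 : ℝ) ≤ t 11 := by rw [le_t_iff (by norm_num)]; norm_num
    rw [div_le_div_iff₀ (by positivity) (by positivity)]
    push_cast
    nlinarith

/-- `p = 7`: exponent `1` is optimal, `G(7^k) ≤ G(7)`. [cite: CaveneyNicolasSondow2012, §2] -/
theorem G_seven_pow_le (k : ℕ) : G (7 ^ k) ≤ G 7 := by
  have h7 : G 7 = 8 / (7 * t 7) := by
    have := G_prime_pow (by norm_num : (7).Prime) 1
    norm_num at this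
    rw [this]
  have ht : 0 < t 7 := t_pos (by norm_num)
  rcases Nat.lt_or_ge k 2 with hk | hk
  · interval_cases k
    · rw [pow_zero, G_one, h7, le_div_iff₀ (by positivity)]
      have : t 7 ≤ 8 / 7 := by rw [t_le_iff (by norm_num)]; norm_num
      linarith
    · simp
  · refine (G_prime_pow_le_tail_of_le (by norm_num) hk).trans ?_
    rw [h7]
    have hlow : (49 / 48 : ℝ) ≤ t 7 := by rw [le_t_iff (by norm_num)]; norm_num
    rw [div_le_div_iff₀ (by positivity) (by positivity)]
    push_cast
    nlinarith

/-- `p = 5`: exponent `1` is optimal, `G(5^k) ≤ G(5)`. [cite: CaveneyNicolasSondow2012, §2] -/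
theorem G_five_pow_le (k : ℕ) : G (5 ^ k) ≤ G 5 := by
  have h5 : G 5 = 6 / (5 * t 5) := by
    have := G_prime_pow (by norm_num : (5).Prime) 1
    norm_num at this
    rw [this]
  have ht : 0 < t 5 := t_pos (by norm_num)
  rcases Nat.lt_or_ge k 2 with hk | hk
  · interval_cases k
    · rw [pow_zero, G_one, h5, le_div_iff₀ (by positivity)]
      have : t 5 ≤ 6 / 5 := by rw [t_le_iff (by norm_num)]; norm_num
      linarith
    · simp
  · refine (G_prime_pow_le_tail_of_le (by norm_num) hk).trans ?_
    rw [h5]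
    have hlow : (25 / 24 : ℝ) ≤ t 5 := by rw [le_t_iff (by norm_num)]; norm_num
    rw [div_le_div_iff₀ (by positivity) (by positivity)]
    push_cast
    nlinarith

/-- `p = 3`: exponent `2` is optimal, `G(3^k) ≤ G(9)`. [cite: CaveneyNicolasSondow2012, §2] -/
theorem G_three_pow_le (k : ℕ) : G (3 ^ k) ≤ G 9 := by
  have h9 : G 9 = 13 / (9 * t 3 ^ 2) := by
    have := G_prime_pow (by norm_num : (3).Prime) 2
    norm_num at this
    rw [this]
    ring
  have ht : 0 < t 3 := t_pos (by norm_num)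
  have hup : t 3 ≤ 13 / 12 := by rw [t_le_iff (by norm_num)]; norm_num
  rcases Nat.lt_or_ge k 4 with hk | hk
  · interval_cases k
    · -- `1 ≤ 13/(9 t²)`
      rw [pow_zero, G_one, h9, le_div_iff₀ (by positivity)]
      nlinarith
    · -- `4/(3t) ≤ 13/(9t²)` iff `12 t ≤ 13`
      have h3 : G (3 ^ 1) = 4 / (3 * t 3) := by
        have := G_prime_pow (by norm_num : (3).Prime) 1
        norm_num at this ⊢
        rw [this]
      rw [h3, h9, div_le_div_iff₀ (by positivity) (by positivity)]
      nlinarith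
    · norm_num
    · -- `40/(27 t³) ≤ 13/(9 t²)` iff `40 ≤ 39 t`
      have h27 : G (3 ^ 3) = 40 / (27 * t 3 ^ 3) := by
        have := G_prime_pow (by norm_num : (3).Prime) 3
        norm_num at this ⊢
        rw [this]
        ring
      have hlow : (40 / 39 : ℝ) ≤ t 3 := by rw [le_t_iff (by norm_num)]; norm_num
      rw [h27, h9, div_le_div_iff₀ (by positivity) (by positivity)]
      nlinarith [pow_pos ht 2, pow_pos ht 3]
  · -- tail with `k₀ = 4`: `(3/2)/t⁴ ≤ 13/(9t²)` iff `27/26 ≤ t²`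
    refine (G_prime_pow_le_tail_of_le (by norm_num) hk).trans ?_
    rw [h9]
    have hlow : (27 / 26 : ℝ) ≤ t 3 ^ 2 := by
      rw [le_t_pow_iff (by norm_num) (by norm_num : (15 : ℕ) ≠ 0) (by norm_num)]
      norm_num
    rw [div_le_div_iff₀ (by positivity) (by positivity)]
    push_cast
    nlinarith [pow_pos ht 2]

/-- `p = 2`: exponent `4` is optimal, `G(2^k) ≤ G(16)`. [cite: CaveneyNicolasSondow2012, §2] -/
theorem G_two_pow_le (k : ℕ) : G (2 ^ k) ≤ G 16 := by
  have h16 : G 16 = 31 / (16 * t 2 ^ 4) := by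
    have := G_prime_pow (by norm_num : (2).Prime) 4
    norm_num at this
    rw [this]
    ring
  have ht : 0 < t 2 := t_pos (by norm_num)
  have hup : t 2 ≤ 31 / 30 := by rw [t_le_iff (by norm_num)]; norm_num
  have ht2 := pow_pos ht 2
  have ht3 := pow_pos ht 3
  have ht4 := pow_pos ht 4
  rcases Nat.lt_or_ge k 6 with hk | hk
  · interval_cases k
    · -- `1 ≤ 31/(16 t⁴)`: `t⁴ ≤ (31/30)⁴ ≤ 31/16`
      rw [pow_zero, G_one, h16, le_div_iff₀ (by positivity)]
      have : t 2 ^ 4 ≤ (31 / 30) ^ 4 := pow_le_pow_left₀ ht.le hup 4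
      nlinarith
    · -- `3/(2t) ≤ 31/(16 t⁴)` iff `24 t³ ≤ 31`
      have h2 : G (2 ^ 1) = 3 / (2 * t 2) := by
        have := G_prime_pow (by norm_num : (2).Prime) 1
        norm_num at this ⊢
        rw [this]
      have hcube : t 2 ^ 3 ≤ 31 / 24 := by
        rw [t_pow_le_iff (by norm_num) (by norm_num : (10 : ℕ) ≠ 0) (by norm_num)]
        norm_num
      rw [h2, h16, div_le_div_iff₀ (by positivity) (by positivity)]
      nlinarith
    · -- `7/(4t²) ≤ 31/(16 t⁴)` iff `28 t² ≤ 31`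
      have h4 : G (2 ^ 2) = 7 / (4 * t 2 ^ 2) := by
        have := G_prime_pow (by norm_num : (2).Prime) 2
        norm_num at this ⊢
        rw [this]
        ring
      have hsq : t 2 ^ 2 ≤ 31 / 28 := by
        rw [t_pow_le_iff (by norm_num) (by norm_num : (15 : ℕ) ≠ 0) (by norm_num)]
        norm_num
      rw [h4, h16, div_le_div_iff₀ (by positivity) (by positivity)]
      nlinarith
    · -- `15/(8t³) ≤ 31/(16 t⁴)` iff `30 t ≤ 31`
      have h8 : G (2 ^ 3) = 15 / (8 * t 2 ^ 3) := by
        have := G_prime_pow (by norm_num : (2).Prime) 3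
        norm_num at this ⊢
        rw [this]
        ring
      rw [h8, h16, div_le_div_iff₀ (by positivity) (by positivity)]
      nlinarith
    · norm_num
    · -- `63/(32 t⁵) ≤ 31/(16 t⁴)` iff `63 ≤ 62 t`
      have h32 : G (2 ^ 5) = 63 / (32 * t 2 ^ 5) := by
        have := G_prime_pow (by norm_num : (2).Prime) 5
        norm_num at this ⊢
        rw [this]
        ring
      have hlow : (63 / 62 : ℝ) ≤ t 2 := by rw [le_t_iff (by norm_num)]; norm_num
      rw [h32, h16, div_le_div_iff₀ (by positivity) (by positivity)]
      nlinarith [pow_pos ht 5]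
  · -- tail with `k₀ = 6`: `2/t⁶ ≤ 31/(16 t⁴)` iff `32/31 ≤ t²`
    refine (G_prime_pow_le_tail_of_le (by norm_num) hk).trans ?_
    rw [h16]
    have hlow : (32 / 31 : ℝ) ≤ t 2 ^ 2 := by
      rw [le_t_pow_iff (by norm_num) (by norm_num : (15 : ℕ) ≠ 0) (by norm_num)]
      norm_num
    rw [div_le_div_iff₀ (by positivity) (by positivity)]
    push_cast
    nlinarith [pow_pos ht 6]

/-- The bound table `B`. [cite: CaveneyNicolasSondow2012, §2] -/
def B (p : ℕ) : ℝ :=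
  if p = 2 then G 16 else if p = 3 then G 9 else if p = 5 then G 5 else if p = 7 then G 7
    else if p = 11 then G 11 else 1

/-- Every prime power is bounded by the table. [cite: CaveneyNicolasSondow2012, §2] -/
theorem G_prime_pow_le_B {p : ℕ} (hp : p.Prime) (k : ℕ) : G (p ^ k) ≤ B p := by
  unfold B
  by_cases h2 : p = 2
  · subst h2; simpa using G_two_pow_le k
  by_cases h3 : p = 3
  · subst h3; simpa using G_three_pow_le k
  by_cases h5 : p = 5
  · subst h5; simpa using G_five_pow_le k
  by_cases h7 : p = 7
  · subst h7; simpa using G_seven_pow_le k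
  by_cases h11 : p = 11
  · subst h11; simpa using G_eleven_pow_le k
  simp only [h2, h3, h5, h7, h11, if_false]
  have h13 : 13 ≤ p := by
    have := hp.two_le
    by_contra hlt
    interval_cases p <;> first | omega | exact absurd hp (by norm_num)
  exact G_prime_pow_le_one hp h13 k

/-- The table entries are at least `1` (they dominate `G(p⁰) = 1`). [folklore] -/
theorem one_le_B (p : ℕ) : 1 ≤ B p := by
  by_cases hp : p.Prime
  · simpa [G_one] using G_prime_pow_le_B hp 0
  · have h2 : p ≠ 2 := fun h => hp (h ▸ Nat.prime_two)
    have h3 : p ≠ 3 := fun h => hp (h ▸ Nat.prime_three)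
    have h5 : p ≠ 5 := fun h => hp (h ▸ (by norm_num))
    have h7 : p ≠ 7 := fun h => hp (h ▸ (by norm_num))
    have h11 : p ≠ 11 := fun h => hp (h ▸ (by norm_num))
    simp [B, h2, h3, h5, h7, h11]

/-- `∏_{p ≤ 11} B_p = G(55440)` by multiplicativity. [folklore] -/
theorem prod_B : ∏ p ∈ ({2, 3, 5, 7, 11} : Finset ℕ), B p = G 55440 := by
  have h : G 55440 = G 16 * G 9 * G 5 * G 7 * G 11 := by
    rw [show (55440 : ℕ) = 16 * 9 * 5 * 7 * 11 by norm_num, G_mul (by norm_num),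
      G_mul (by norm_num), G_mul (by norm_num), G_mul (by norm_num)]
  rw [h]
  simp [B, Finset.prod_insert]
  ring

/-- **The maximisation**: `G(m) ≤ G(55440)` for every `m ≥ 1`, i.e. `1/30` is a parameter of
`55440`. [cite: CaveneyNicolasSondow2012, §2] -/
theorem G_le (m : ℕ) (hm : 1 ≤ m) : G m ≤ G 55440 := by
  classical
  set T : Finset ℕ := {2, 3, 5, 7, 11} with hT
  have hm0 : m ≠ 0 := by omega
  -- `G m ≤ ∏_{p | m} B p`
  have h1 : G m ≤ ∏ p ∈ m.primeFactors, B p := by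
    rw [G_eq_prod hm0]
    exact Finset.prod_le_prod (fun p _ => G_nonneg _)
      (fun p hp => G_prime_pow_le_B (Nat.prime_of_mem_primeFactors hp) _)
  -- `∏_{p | m} B p = ∏_{p | m, p ∈ T} B p`
  have h2 : ∏ p ∈ m.primeFactors, B p = ∏ p ∈ m.primeFactors ∩ T, B p := by
    symm
    apply Finset.prod_subset Finset.inter_subset_left
    intro p hp hpT
    have hpT' : p ∉ T := fun h => hpT (Finset.mem_inter.2 ⟨hp, h⟩)
    simp only [hT, Finset.mem_insert, Finset.mem_singleton, not_or] at hpT'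
    obtain ⟨h2, h3, h5, h7, h11⟩ := hpT'
    simp [B, h2, h3, h5, h7, h11]
  -- `∏_{p ∈ m.primeFactors ∩ T} B p ≤ ∏_{p ∈ T} B p`
  have h3 : ∏ p ∈ m.primeFactors ∩ T, B p ≤ ∏ p ∈ T, B p := by
    have hsplit := Finset.prod_sdiff (f := B) (Finset.inter_subset_right : m.primeFactors ∩ T ⊆ T)
    rw [← hsplit]
    have hge : 1 ≤ ∏ p ∈ T \ (m.primeFactors ∩ T), B p :=
      Finset.prod_induction B (fun x => 1 ≤ x) (fun a b ha hb => one_le_mul_of_one_le_of_one_le ha hb)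
        le_rfl (fun p _ => one_le_B p)
    have hnn : 0 ≤ ∏ p ∈ m.primeFactors ∩ T, B p :=
      Finset.prod_nonneg fun p _ => zero_le_one.trans (one_le_B p)
    calc ∏ p ∈ m.primeFactors ∩ T, B p = 1 * ∏ p ∈ m.primeFactors ∩ T, B p := (one_mul _).symm
      _ ≤ (∏ p ∈ T \ (m.primeFactors ∩ T), B p) * ∏ p ∈ m.primeFactors ∩ T, B p :=
        mul_le_mul_of_nonneg_right hge hnn
  calc G m ≤ ∏ p ∈ m.primeFactors, B p := h1
    _ = ∏ p ∈ m.primeFactors ∩ T, B p := h2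
    _ ≤ ∏ p ∈ T, B p := h3
    _ = G 55440 := prod_B

end CA55440

/-- **`55440` is colossally abundant** (Alaoglu–Erdős 1944, §3, table; Caveney–Nicolas–Sondow
2012, §2), with parameter `ε = 1/30`: discharges the named fact `Nat.colossallyAbundant_55440` of
`RobinCriterion.lean` (whose statement is literally `Nat.ColossallyAbundant 55440`).
[cite: CaveneyNicolasSondow2012, §2 (list of CA numbers)] -/
theorem colossallyAbundant_55440_holds : ColossallyAbundant 55440 :=
  ⟨by norm_num, CA55440.ε, CA55440.ε_pos, fun m hm => CA55440.G_le m hm⟩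

end Nat

end
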